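import Summits.Ventures.CertifiedManyBodySolver.Downfold.EmeryScaleEdgeChain
import Summits.Ventures.CertifiedManyBodySolver.Downfold.EmeryScalingLaw
import HarnessLib

/-!
# THE TELESCOPED-EDGE / SCALING-RAY BOX RULE FOR THE SCALE COORDINATE: `L ≤ t_node(θ; ε_F(θ; ν)) ≤ U` for EVERY member `θ` of a typed thin-`t_pp′`
# three-band box, from edge brackets, value leaves, `t_pp` stages and oxygen-hopping ray stages — no `Δ`-monotonicity, no `t_pd` lever (INFL-3to1-B §B.91 (d))

Venture CertifiedManyBodySolver, cell `pub/hubbard-downfold` (stage S1; INFLATION-RULES-3to1-B §B.91), seat hubbard-downfold-mod-4 (technique B = band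
level, g40); namespace `Summit.Ventures.CertifiedManyBodySolver.Downfold.Emery`. Everything PROVED (0 sorry). WHAT THIS IS NOT: a statement about any
material; no number lives here; `U = 0` one-body kinematics of the σ model.

THE DEVICE. Box `[Δ₁, Δ₂] × [a₁, a₂] × [b₁, b₂] × {c}` (charge-transfer energy, `t_pd`, `t_pp`, one `t_pp′`), filling `ν`. UPPER: a member
`θ = (Δ, a, b, c)` is `μ⁻¹·(μΔ, a₂, μb, μc)` with `μ = a₂/a ∈ [1, a₂/a₁]`, and **`T(θ) = T(μθ)/μ`** exactly (`fermiEnergyOf_smul` of `EmeryScalingLaw` and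
the degree-one homogeneity `scaleNode_div_smul` below). The scaled point lies on the oxygen-hopping ray from `(μΔ, a₂, b, c)`, whose `t_pp` stage from the
CEILING EDGE `(μΔ, a₂, b₂, c)` and whose edge value are certified cell by cell (`EmeryScaleEdgeChain.edge_cell_upper`) along the EXTENDED edge
`Δ′ ∈ [Δ₁, (a₂/a₁)Δ₂]`, telescoped by point brackets: **`T(θ) ≤ U`**. LOWER: `μ′ = a₁/a ∈ [a₁/a₂, 1]`, floor edge `(Δ′, a₁, b₁, c)`,
`Δ′ ∈ [(a₁/a₂)Δ₁, Δ₂]`, ray DOWN the oxygen hoppings: **`L ≤ T(θ)`**. Hypotheses left to the instance: the edge windows (two brackets per cell end,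
`edgeWindow_of_brackets`), two member floors (UPPER), and `norm_num` inequalities on the box corners.

* §1 `scaleNode_div_smul`, `scaleT_fixedFilling_smul` (homogeneity of `t_node` and of `T`).
* §2 `edgeBoxCheck`; **`edgebox_upper`**, **`edgebox_lower`**; `edgeWindow_of_brackets`.

Sources: three-band model [HybertsenSchluterChristensen1989, Eq. (1)]; energy-linearised one-band image [AndersenEtAl1995, §6]; interval arithmetic
[folklore] (Moore 1966).
-/

noncomputable section

namespace Summit.Ventures.CertifiedManyBodySolver.Downfold.Emery

open Real Set Literature.Analysis.ValidatedNumerics.Numerics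

/-! ## §1 Homogeneity -/

/-- `scaleNodeN` is homogeneous of degree 7. [folklore] -/
theorem scaleNodeN_smul (l Δ a b c e : ℝ) :
    scaleNodeN (l * Δ) (l * a) (l * b) (l * c) (l * e) = l ^ 7 * scaleNodeN Δ a b c e := by
  rw [scaleNodeN_eq_sn, scaleNodeN_eq_sn]; unfold snF snR snP; ring

/-- `scaleNodeD` is homogeneous of degree 6. [folklore] -/
theorem scaleNodeD_smul (l Δ a b c e : ℝ) :
    scaleNodeD (l * Δ) (l * a) (l * b) (l * c) (l * e) = l ^ 6 * scaleNodeD Δ a b c e := by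
  rw [scaleNodeD_eq_sn, scaleNodeD_eq_sn]; unfold snE snG snQ snP; ring

/-- **`t_node` IS HOMOGENEOUS OF DEGREE ONE**: `t((lθ); le) = l·t(θ; e)` for `l > 0`. [folklore] -/
theorem scaleNode_div_smul {l : ℝ} (hl : 0 < l) (Δ a b c e : ℝ) :
    scaleNodeN (l * Δ) (l * a) (l * b) (l * c) (l * e) / scaleNodeD (l * Δ) (l * a) (l * b) (l * c) (l * e) =
      l * (scaleNodeN Δ a b c e / scaleNodeD Δ a b c e) := by
  rw [scaleNodeN_smul, scaleNodeD_smul]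
  have hl6 : l ^ 6 ≠ 0 := pow_ne_zero _ hl.ne'
  rw [show l ^ 7 * scaleNodeN Δ a b c e = l * (l ^ 6 * scaleNodeN Δ a b c e) by ring, mul_div_assoc, mul_div_mul_left _ _ hl6]

/-- **THE FIXED-FILLING SCALE COORDINATE IS HOMOGENEOUS OF DEGREE ONE**: `T(lθ; ν) = l·T(θ; ν)` (`fermiEnergyOf_smul`). [folklore] -/
theorem scaleT_fixedFilling_smul {l : ℝ} (hl : 0 < l) (Δ a b c ν : ℝ) :
    scaleNodeN (l * Δ) (l * a) (l * b) (l * c) (fermiEnergyOf (l * Δ) (l * a) (l * b) (l * c) ν) /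
        scaleNodeD (l * Δ) (l * a) (l * b) (l * c) (fermiEnergyOf (l * Δ) (l * a) (l * b) (l * c) ν) =
      l * (scaleNodeN Δ a b c (fermiEnergyOf Δ a b c ν) / scaleNodeD Δ a b c (fermiEnergyOf Δ a b c ν)) := by
  rw [fermiEnergyOf_smul hl]; exact scaleNode_div_smul hl Δ a b c _

/-! ## §2 The box rule -/

/-- **`edgeBoxCheck`**: the `Δ′`-cells cover the scaled extended edge `[Dlo, Dhi]` and each passes `edgeCellOK`. [folklore] -/
def edgeBoxCheck (upper : Bool) (IC IA IB : FI) (wB sR V whlo whlo2 Dlo Dhi : ℤ) (cells : List ECell) : Bool :=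
  coversBy ECell.iD Dlo Dhi cells && cells.all (edgeCellOK upper IC IA IB wB sR V whlo whlo2)

/-- **THE EDGE WINDOW FROM TWO BRACKETS**: on a `Δ′`-cell `[Δl, Δr]` (exact scaled endpoints), `ε_F(Δl) ≤ eh` and `el ≤ ε_F(Δr)` give
`ε_F(Δ′) ∈ W ⊇ [el, eh]` for every `Δ′` of the cell (`ε_F` is non-increasing in `Δ`). [folklore] -/
theorem edgeWindow_of_brackets {Δ' Δl Δr a b c ν el eh : ℝ} {iD W : FI} (hΔl : 0 < Δl) (ha : 0 < a) (hb : 0 ≤ b) (hc : 0 ≤ c) (hν0 : 0 < ν)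
    (hν1 : ν < 1) (hDl : Δl * SC ≤ (iD.lo : ℝ)) (hDr : (iD.hi : ℝ) ≤ Δr * SC) (hD : FI.mem Δ' iD)
    (hbl : fermiEnergyOf Δl a b c ν ≤ eh) (hbr : el ≤ fermiEnergyOf Δr a b c ν) (hWlo : (W.lo : ℝ) ≤ el * SC) (hWhi : eh * SC ≤ (W.hi : ℝ)) :
    FI.mem (fermiEnergyOf Δ' a b c ν) W := by
  have h1 : Δl ≤ Δ' := by have := hDl.trans hD.1; nlinarith [SC_pos]
  have h2 : Δ' ≤ Δr := by have := hD.2.trans hDr; nlinarith [SC_pos]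
  have hm := fermiEnergyOf_mem_Icc_of_mem_box' (Δ := Δ') (a := a) (b := b) (c := c) hΔl ha hb hc ⟨h1, h2⟩ ⟨le_rfl, le_rfl⟩ ⟨le_rfl, le_rfl⟩
    ⟨le_rfl, le_rfl⟩ hν0 hν1
  refine ⟨?_, ?_⟩
  · have := hm.1; nlinarith [SC_pos]
  · have := hm.2; nlinarith [SC_pos]

section Box

variable {IC IA IB : FI} {wB sR V whlo whlo2 Dlo Dhi : ℤ} {cells : List ECell} {Δ₁ Δ₂ a₁ a₂ b₁ b₂ c ν : ℝ}

/-- **THE UPPER BOX RULE (telescoped ceiling edge + scaling ray).** For every member `(Δ, a, b, c)` of `[Δ₁, Δ₂] × [a₁, a₂] × [b₁, b₂] × {c}`: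
**`T(Δ, a, b, c; ν) ≤ V/SC`**, given the kernel check, the edge windows of every cell for the edge `(·, a₂, b₂, c)`, the two member floors at
`((a₂/a₁)Δ₂, a₂, b₁, c)` and `((a₂/a₁)Δ₂, a₂, b₁, (a₂/a₁)c)`, and the corner arithmetic. [folklore] -/
theorem edgebox_upper (h : edgeBoxCheck true IC IA IB wB sR V whlo whlo2 Dlo Dhi cells = true) (hC : FI.mem c IC) (hA2 : FI.mem a₂ IA)
    (hB2 : FI.mem b₂ IB) (hν0 : 0 < ν) (hν1 : ν < 1) (hΔ₁ : 0 < Δ₁) (ha₁ : 0 < a₁) (hb₁ : 0 ≤ b₁) (hc0 : 0 ≤ c)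
    (hDlo : (Dlo : ℝ) ≤ Δ₁ * SC) (hDhi : a₂ / a₁ * Δ₂ * SC ≤ (Dhi : ℝ)) (hwB : (b₂ - b₁) * SC ≤ (wB : ℝ)) (hsR : (a₂ / a₁ - 1) * SC ≤ (sR : ℝ))
    (hWs : ∀ ec ∈ cells, ∀ Δ' : ℝ, FI.mem Δ' ec.iD → FI.mem (fermiEnergyOf Δ' a₂ b₂ c ν) ec.W)
    (hfloor : (whlo : ℝ) / SC ≤ fermiEnergyOf (a₂ / a₁ * Δ₂) a₂ b₁ c ν)
    (hfloor2 : (whlo2 : ℝ) / SC ≤ fermiEnergyOf (a₂ / a₁ * Δ₂) a₂ b₁ (a₂ / a₁ * c) ν)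
    {Δ a b : ℝ} (hΔ : Δ ∈ Icc Δ₁ Δ₂) (ha : a ∈ Icc a₁ a₂) (hb : b ∈ Icc b₁ b₂) :
    scaleNodeN Δ a b c (fermiEnergyOf Δ a b c ν) / scaleNodeD Δ a b c (fermiEnergyOf Δ a b c ν) ≤ (V : ℝ) / SC := by
  simp only [edgeBoxCheck, Bool.and_eq_true] at h
  obtain ⟨hcov, hall⟩ := h
  have ha0 : 0 < a := lt_of_lt_of_le ha₁ ha.1
  have hΔ0 : 0 < Δ := lt_of_lt_of_le hΔ₁ hΔ.1
  have ha₂ : 0 < a₂ := lt_of_lt_of_le ha0 ha.2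
  set μ : ℝ := a₂ / a with hμ
  have hμ0 : 0 < μ := div_pos ha₂ ha0
  have hμ1 : 1 ≤ μ := by rw [hμ, one_le_div ha0]; exact ha.2
  have hμtop : μ ≤ a₂ / a₁ := div_le_div_of_nonneg_left ha₂.le ha₁ ha.1
  set s : ℝ := μ - 1 with hs
  have hs0 : 0 ≤ s := by rw [hs]; linarith
  set Δ' : ℝ := μ * Δ with hΔ'
  -- the scaled point lies on the extended edge range
  have hD1 : (Dlo : ℝ) ≤ Δ' * SC := by
    have : Δ ≤ Δ' := by rw [hΔ']; nlinarith
    nlinarith [SC_pos, hΔ.1]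
  have hDtop : Δ' ≤ a₂ / a₁ * Δ₂ := by rw [hΔ']; exact mul_le_mul hμtop hΔ.2 hΔ0.le (by positivity)
  have hD2 : Δ' * SC ≤ (Dhi : ℝ) := by nlinarith [SC_pos]
  obtain ⟨ec, hec, hDm⟩ := exists_of_coversBy ECell.iD cells Dlo Dhi hcov Δ' hD1 hD2
  have hok := List.all_eq_true.1 hall ec hec
  have hW := hWs ec hec Δ' hDm
  have hΔ'0 : 0 < Δ' := mul_pos hμ0 hΔ0
  -- ranges of b and s
  have hb2' : (b₂ - b) * SC ≤ (wB : ℝ) := by nlinarith [SC_pos, hb.1]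
  have hsle : s ≤ a₂ / a₁ - 1 := by rw [hs]; linarith
  have hsR' : s * SC ≤ (sR : ℝ) := by nlinarith [SC_pos]
  -- member floors by monotonicity from the two bracketed points
  have hb0 : 0 ≤ b := hb₁.trans hb.1
  have hcrude : (whlo : ℝ) / SC ≤ fermiEnergyOf Δ' a₂ b c ν := by
    refine hfloor.trans ?_
    exact (fermiEnergyOf_mem_Icc_of_mem_box' (Δ := Δ') (a := a₂) (b := b) (c := c) hΔ'0 ha₂ hb₁ hc0 ⟨le_rfl, hDtop⟩ ⟨le_rfl, le_rfl⟩
      ⟨hb.1, le_rfl⟩ ⟨le_rfl, le_rfl⟩ hν0 hν1).1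
  have hcrude2 : (whlo2 : ℝ) / SC ≤ fermiEnergyOf Δ' a₂ (b + s * b) (c + s * c) ν := by
    refine hfloor2.trans ?_
    have e1 : b + s * b = μ * b := by rw [hs]; ring
    have e2 : c + s * c = μ * c := by rw [hs]; ring
    rw [e1, e2]
    have hbμ : b₁ ≤ μ * b := hb.1.trans (by nlinarith)
    have hcμ : 0 ≤ μ * c := by positivity
    exact (fermiEnergyOf_mem_Icc_of_mem_box' (Δ := Δ') (a := a₂) (b := μ * b) (c := μ * c) hΔ'0 ha₂ hb₁ hcμ ⟨le_rfl, hDtop⟩ ⟨le_rfl, le_rfl⟩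
      ⟨hbμ, le_rfl⟩ ⟨le_rfl, mul_le_mul_of_nonneg_right hμtop hc0⟩ hν0 hν1).1
  have key := edge_cell_upper hok hC hA2 hB2 hν0 hν1 hDm hW hb.2 hb2' hs0 hsR' hcrude hcrude2
  -- rewrite the member as the scaled point and use homogeneity
  have e0 : a₂ = μ * a := by rw [hμ]; field_simp
  have e1 : b + s * b = μ * b := by rw [hs]; ring
  have e2 : c + s * c = μ * c := by rw [hs]; ring
  have e3 : 1 + s = μ := by rw [hs]; ring
  rw [e0, e1, e2, e3, hΔ', scaleT_fixedFilling_smul hμ0] at key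
  exact le_of_mul_le_mul_left key hμ0

/-- **THE LOWER BOX RULE (telescoped floor edge + scaling ray).** For every member `(Δ, a, b, c)` of `[Δ₁, Δ₂] × [a₁, a₂] × [b₁, b₂] × {c}`:
**`V/SC ≤ T(Δ, a, b, c; ν)`**, given the kernel check, the edge windows of every cell for the edge `(·, a₁, b₁, c)` and the corner arithmetic.
[folklore] -/
theorem edgebox_lower (h : edgeBoxCheck false IC IA IB wB sR V whlo whlo2 Dlo Dhi cells = true) (hC : FI.mem c IC) (hA1 : FI.mem a₁ IA)
    (hB1 : FI.mem b₁ IB) (hν0 : 0 < ν) (hν1 : ν < 1) (hΔ₁ : 0 < Δ₁) (ha₁ : 0 < a₁)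
    (hDlo : (Dlo : ℝ) ≤ a₁ / a₂ * Δ₁ * SC) (hDhi : Δ₂ * SC ≤ (Dhi : ℝ)) (hwB : (b₂ - b₁) * SC ≤ (wB : ℝ)) (hsR : (1 - a₁ / a₂) * SC ≤ (sR : ℝ))
    (hWs : ∀ ec ∈ cells, ∀ Δ' : ℝ, FI.mem Δ' ec.iD → FI.mem (fermiEnergyOf Δ' a₁ b₁ c ν) ec.W)
    {Δ a b : ℝ} (hΔ : Δ ∈ Icc Δ₁ Δ₂) (ha : a ∈ Icc a₁ a₂) (hb : b ∈ Icc b₁ b₂) :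
    (V : ℝ) / SC ≤ scaleNodeN Δ a b c (fermiEnergyOf Δ a b c ν) / scaleNodeD Δ a b c (fermiEnergyOf Δ a b c ν) := by
  simp only [edgeBoxCheck, Bool.and_eq_true] at h
  obtain ⟨hcov, hall⟩ := h
  have ha0 : 0 < a := lt_of_lt_of_le ha₁ ha.1
  have hΔ0 : 0 < Δ := lt_of_lt_of_le hΔ₁ hΔ.1
  have ha₂ : 0 < a₂ := lt_of_lt_of_le ha0 ha.2
  set μ : ℝ := a₁ / a with hμ
  have hμ0 : 0 < μ := div_pos ha₁ ha0
  have hμ1 : μ ≤ 1 := by rw [hμ, div_le_one ha0]; exact ha.1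
  have hμbot : a₁ / a₂ ≤ μ := div_le_div_of_nonneg_left ha₁.le ha0 ha.2
  set s : ℝ := 1 - μ with hs
  have hs0 : 0 ≤ s := by rw [hs]; linarith
  have hs1 : s ≤ 1 := by rw [hs]; linarith
  set Δ' : ℝ := μ * Δ with hΔ'
  have hD1 : (Dlo : ℝ) ≤ Δ' * SC := by
    have : a₁ / a₂ * Δ₁ ≤ Δ' := by rw [hΔ']; exact mul_le_mul hμbot hΔ.1 hΔ₁.le hμ0.le
    nlinarith [SC_pos]
  have hD2 : Δ' * SC ≤ (Dhi : ℝ) := by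
    have : Δ' ≤ Δ₂ := by rw [hΔ']; nlinarith [hΔ.2]
    nlinarith [SC_pos]
  obtain ⟨ec, hec, hDm⟩ := exists_of_coversBy ECell.iD cells Dlo Dhi hcov Δ' hD1 hD2
  have hok := List.all_eq_true.1 hall ec hec
  have hW := hWs ec hec Δ' hDm
  have hb2' : (b - b₁) * SC ≤ (wB : ℝ) := by nlinarith [SC_pos, hb.2]
  have hsle : s ≤ 1 - a₁ / a₂ := by rw [hs]; linarith
  have hsR' : s * SC ≤ (sR : ℝ) := by nlinarith [SC_pos]
  have key := edge_cell_lower hok hC hA1 hB1 hν0 hν1 hDm hW hb.1 hb2' hs0 hsR' hs1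
  have e0 : a₁ = μ * a := by rw [hμ]; field_simp
  have e1 : b - s * b = μ * b := by rw [hs]; ring
  have e2 : c - s * c = μ * c := by rw [hs]; ring
  have e3 : 1 - s = μ := by rw [hs]; ring
  rw [e0, e1, e2, e3, hΔ', scaleT_fixedFilling_smul hμ0] at key
  exact le_of_mul_le_mul_left key hμ0

end Box

end Summit.Ventures.CertifiedManyBodySolver.Downfold.Emery
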